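import Literature.AnabelianGeometry.SemiGraphs.TemperedPiFrameTransport
import HarnessLib

/-!
# Branch transit in the trees of a Galois tower: every branch at `P.vertex N` is a glued branch of a
# translate of `P` ([SemiAnbd] Rmk 2.2.1, Thm 3.7 (iii))

Mochizuki, *Semi-graphs of anabelioids*, Publ. RIMS **42** (2006), Remark 2.2.1 p. 24, Theorem 3.7 (iii)
p. 41 [cite: MochizukiSemiAnbd2006, Rmk 2.2.1 p.24].

PROOF-ONLY file (abc-iut cell, layer L3, row «RAYLESS-STAR·CIV-NEG» brick S5d-3a, seat abc-iut-L3-t8 gen 6;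
no definition, no named fact).  GENERIC over a Galois tower `D : GaloisLevelData 𝒢` (abc-iut-L3-t6/t9/t11/d4
vocabulary consumed BY NAME):

* `PointSeq.smul_smul`, `PointSeq.toEdgeSeq_smul`, `EdgeSeq.gluePointSeq_smul`,
  `EdgeSeq.toEdgeSeq_gluePointSeq` — the translation action commutes with un-gluing / gluing;
* `PointSeq.exists_edgeOf_eq_toEdgeSeq_edge` — **BRANCH TRANSIT** (the choice-free half of abc-iut-L3-d4's
  `exists_transport_of_branchMap_eq`): every branch `β` of the tree `𝔾̃_N` abutting to `P.vertex N` and lying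
  over the branch `b` of `𝔾` at `w` has the edge `((gᵥ⁻¹ · P).toEdgeSeq b).edge N` for some `gᵥ ∈ Π_w`
  (`Π_w` acts transitively on the lifts of `b` at `P.vertex N`);
* `SemiGraph.abuts_eq_of_joins` — in a tree, the other branch of an edge joining `u` to `v` whose first
  branch is at `u` abuts to `v`.

Consumer: the tree walk of the rayless escape (`MetabelianLeafStarTreeWalk.lean`).  Nothing here bears on
[IUTchIII] Cor. 3.12; typed ≠ proved.
-/

namespace Literature.AnabelianGeometry.SemiGraphs

/-! ### The other branch of a joining edge -/

namespace SemiGraph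

universe u

variable {G : SemiGraph.{u}}

/-- **In an acyclic semi-graph, the other branch of an edge joining `u` to `v`, whose first branch is at `u`,
abuts to `v`** (an edge has exactly two branches, and at most one at a given vertex).
[cite: MochizukiSemiAnbd2006, §1 p.11] -/
theorem abuts_eq_of_joins (hG : G.subdivision.IsAcyclic) {e : G.Edge} {u v : G.Vertex} (hj : G.Joins e u v)
    {c c' : G.Branch} (hce : G.edgeOf c = e) (hc'e : G.edgeOf c' = e) (hcc' : c ≠ c')
    (hc : G.abuts c = some u) : G.abuts c' = some v := by
  obtain ⟨β₁, β₂, hne, h₁, h₂, hβ₁, hβ₂⟩ := hj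
  have hc1 : c = β₁ := branch_unique_of_isAcyclic hG (hce.trans h₁.symm) hc hβ₁
  obtain ⟨b₁, b₂, -, -, -, hall⟩ := G.two_branches e
  have hc'β₁ : c' ≠ β₁ := fun h => hcc' (hc1.trans h.symm)
  have key : c' = β₂ := by
    rcases hall c' hc'e with hc' | hc' <;> rcases hall β₂ h₂ with hβ2 | hβ2
    · exact hc'.trans hβ2.symm
    · rcases hall β₁ h₁ with hβ1 | hβ1
      · exact absurd (hc'.trans hβ1.symm) hc'β₁
      · exact absurd (hβ1.trans hβ2.symm) hne
    · rcases hall β₁ h₁ with hβ1 | hβ1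
      · exact absurd (hβ1.trans hβ2.symm) hne
      · exact absurd (hc'.trans hβ1.symm) hc'β₁
    · exact hc'.trans hβ2.symm
  rw [key]; exact hβ₂

end SemiGraph

namespace ProfiniteSemiGraph

namespace GaloisLevelData

open CategoryTheory Topology

universe u

variable {𝒢 : ProfiniteSemiGraph.{u}} {D : GaloisLevelData 𝒢} {h𝒢 : 𝒢.IsCountable}

/-! ### The translation action commutes with un-gluing and gluing -/

namespace PointSeq

variable {w : 𝒢.graph.Vertex} (P : D.PointSeq h𝒢 w)

/-- `g' · (g · P) = (g' g) · P`. [cite: MochizukiSemiAnbd2006, Thm 3.7(i) p.40] -/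
theorem smul_smul (g g' : D.temperedPi h𝒢) : (P.smul g).smul g' = P.smul (g' * g) := by
  apply PointSeq.ext
  intro n
  rw [smul_pt, smul_pt, smul_pt, map_mul]
  rfl

/-- **Un-gluing commutes with the translation action.** [cite: MochizukiSemiAnbd2006, Thm 3.7(iii) p.41] -/
theorem toEdgeSeq_smul (b : 𝒢.graph.Branch) (hb : 𝒢.graph.abuts b = some w) (g : D.temperedPi h𝒢) :
    (P.smul g).toEdgeSeq b hb = (P.toEdgeSeq b hb).smul g := by
  apply EdgeSeq.ext
  intro n
  apply Function.LeftInverse.injective ((D.cover h𝒢 n).glue_inv_hom b w hb)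
  rw [toEdgeSeq_pt, smul_pt, (D.cover h𝒢 n).glue_hom_inv, EdgeSeq.smul_pt, CovHom.glue_fE, toEdgeSeq_pt,
    (D.cover h𝒢 n).glue_hom_inv]

end PointSeq

namespace EdgeSeq

variable {e : 𝒢.graph.Edge} (Q : D.EdgeSeq h𝒢 e)

/-- **Gluing commutes with the translation action.** [cite: MochizukiSemiAnbd2006, Thm 3.7(iii) p.41] -/
theorem gluePointSeq_smul (b : 𝒢.graph.Branch) (v : 𝒢.graph.Vertex) (hb : 𝒢.graph.abuts b = some v)
    (hbe : 𝒢.graph.edgeOf b = e) (g : D.temperedPi h𝒢) :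
    (Q.smul g).gluePointSeq b v hb hbe = (Q.gluePointSeq b v hb hbe).smul g := by
  subst hbe
  apply PointSeq.ext
  intro n
  rw [gluePointSeq_pt, smul_pt, PointSeq.smul_pt, gluePointSeq_pt, CovHom.glue_fE]

/-- **Un-gluing a glued sequence along the same branch gives it back.** [cite: MochizukiSemiAnbd2006, Thm 3.7(iii) p.41] -/
theorem toEdgeSeq_gluePointSeq (b : 𝒢.graph.Branch) (v : 𝒢.graph.Vertex) (hb : 𝒢.graph.abuts b = some v)
    (Q : D.EdgeSeq h𝒢 (𝒢.graph.edgeOf b)) : (Q.gluePointSeq b v hb rfl).toEdgeSeq b hb = Q := by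
  apply EdgeSeq.ext
  intro n
  rw [PointSeq.toEdgeSeq_pt, gluePointSeq_pt, (D.cover h𝒢 n).glue_inv_hom]

end EdgeSeq

/-! ### Branch transit -/

namespace PointSeq

variable {w : 𝒢.graph.Vertex} (P : D.PointSeq h𝒢 w)

/-- **BRANCH TRANSIT** ([SemiAnbd] Rmk 2.2.1 at one level of a Galois tower): every branch `β` of `𝔾̃_N`
abutting to `P.vertex N` and lying over the branch `b` of `𝔾` at `w` has edge `((gᵥ⁻¹ · P).toEdgeSeq b).edge N`
for some `gᵥ ∈ Π_w` — the un-glued edge of a translate of `P` by an element of its own decomposition group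
(which has the same vertices). [cite: MochizukiSemiAnbd2006, Rmk 2.2.1 p.24] -/
theorem exists_edgeOf_eq_toEdgeSeq_edge (N : ℕ) (b : 𝒢.graph.Branch) (hb : 𝒢.graph.abuts b = some w)
    (β : (D.tree N).Branch) (hβb : (D.treeProj N).branchMap β = b)
    (hβ : (D.tree N).abuts β = some (P.vertex N)) :
    ∃ gᵥ : 𝒢.Gv w, (D.tree N).edgeOf β = ((P.smul (P.decompHom gᵥ⁻¹)).toEdgeSeq b hb).edge N := by
  set β₀ := (D.treeIso h𝒢 N).inv.branchMap β with hβ₀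
  have hβeq : β = (D.treeIso h𝒢 N).hom.branchMap β₀ := (D.treeIso_hom_branchMap_inv h𝒢 N β).symm
  have hβ₀b : (D.cover h𝒢 N).orbitGraphProj.branchMap β₀ = b := by
    rw [← hβb, hβeq, D.treeProj_branchMap_treeIso h𝒢]; rfl
  obtain ⟨y, hy⟩ := (D.cover h𝒢 N).exists_eq_brOf b hb β₀ hβ₀b
  have hβ₀abuts : (D.cover h𝒢 N).orbitGraph.abuts β₀ = some (Quot.mk _ ⟨w, P.pt N⟩) := by
    apply D.orbitGraph_abuts_of_tree_abuts h𝒢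
    rw [← hβeq]
    exact hβ
  rw [hy, (D.cover h𝒢 N).abuts_brOf b hb y] at hβ₀abuts
  obtain ⟨gᵥ, hgᵥ⟩ := (D.cover h𝒢 N).exists_ρ_of_mk_eq_mk (Option.some.inj hβ₀abuts).symm
  refine ⟨gᵥ, ?_⟩
  set P_y := P.smul (P.decompHom gᵥ⁻¹) with hP_y
  have hPy_pt : P_y.pt N = y := by rw [hP_y, P.smul_decompHom_inv_pt, hgᵥ]
  have hbr : (D.cover h𝒢 N).brOf b hb y =
      ⟨(b, Quot.mk _ ⟨𝒢.graph.edgeOf b, (P_y.toEdgeSeq b hb).pt N⟩), rfl⟩ := by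
    rw [P_y.toEdgeSeq_pt, hPy_pt]; rfl
  rw [hβeq, hy, hbr]
  exact (P_y.toEdgeSeq b hb).edgeOf_treeIso_branchMap b rfl N

/-- **The level-`N` component of an element fixing `P.vertex N` is a `σ_N^k`; composing, the element differs
from `ψ_P(k)` by an element of `ker ρ_N`.** [cite: MochizukiSemiAnbd2006, Thm 3.7(iii) p.41] -/
theorem exists_proj_mul_decompHom_inv_eq_one (N : ℕ) (g : D.temperedPi h𝒢)
    (hg : (D.treeAct h𝒢 N g).hom.vertexMap (P.vertex N) = P.vertex N) :
    ∃ k : 𝒢.Gv w, D.proj h𝒢 N (g * (P.decompHom k)⁻¹) = 1 := by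
  obtain ⟨k, hk⟩ := P.exists_gal_eq_proj_of_fixes N g hg
  exact ⟨k, by rw [map_mul, map_inv, P.proj_decompHom, hk, mul_inv_cancel]⟩

/-- Two translates of `P` with the same level-`N` vertex differ, modulo `ker ρ_N`, by a decomposition image:
`ρ_N(g' g⁻¹ ψ_{g·P}(k)⁻¹) = 1`. [cite: MochizukiSemiAnbd2006, Thm 3.7(iii) p.41] -/
theorem exists_proj_eq_one_of_smul_vertex_eq (N : ℕ) (g g' : D.temperedPi h𝒢)
    (h : (P.smul g).vertex N = (P.smul g').vertex N) :
    ∃ k : 𝒢.Gv w, D.proj h𝒢 N (g' * g⁻¹ * (g * P.decompHom k * g⁻¹)⁻¹) = 1 := by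
  have h1 : ((P.smul g).smul (g' * g⁻¹)).vertex N = (P.smul g).vertex N := by
    rw [P.smul_smul, inv_mul_cancel_right, h]
  rw [PointSeq.smul_vertex] at h1
  obtain ⟨k, hk⟩ := (P.smul g).exists_proj_mul_decompHom_inv_eq_one N (g' * g⁻¹) h1
  refine ⟨k, ?_⟩
  rw [P.decompHom_smul] at hk
  exact hk

end PointSeq

end GaloisLevelData

end ProfiniteSemiGraph

end Literature.AnabelianGeometry.SemiGraphs
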